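import Summits.QuantumFields.BalabanUV.Beta.GAN24.S3ShapeVt
import Summits.QuantumFields.BalabanUV.Beta.GAN24.TaylorMassVHSymAt
import Summits.QuantumFields.BalabanUV.Beta.GAN24.E3UnitSplitLevelsVSymAt

/-!
# `BalabanUV.Beta.GAN24.S3ShapeVtSymAt` (SYMMETRIC comb table, OWNER W15; the `borderIncAt` twin is `S3ShapeVtAt` p298455) — binder row G-an2-4 / (CONV-C), road S3 AT THE IN-BLOCK ROOT, V half: package (ρV-c), part 3, of «ROOTED-S3-V»
# (OWNER gan24-p1-g21 (W11) «GO NOW, WANTED»; `gen21/BORNV-PLAN-v0.md` §3) — **ROAD S3's TOP V ROW (`S3ShapeVt.shapeVt_three`) RE-RUN FOR an2's ROOTED BORDER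
# SYMMETRIC BORDER SUM `DecLiftAdjoint.borderSum (Lc^(n+1)) (vhSAt (toSite r) 3 Lc)` (no `mfNeg`)** ⇒ END **`shapeVt_three_at`**: `∃ CtV δ, 0 < δ ∧ ∀ r ∈ box (3+1) Lc, ∀ n, LocStencil (N^{2(d+1)}·e3OfS N
# ((cVH·(Lc^(n+1))^5) • borderSum (Lc^(n+1)) (fun κ₀ z₀ => vhSAt (toSite r) 3 Lc rfl κ₀ z₀) κ u)) CtV δ` — the SAME constants as the base row, constants BEFORE the root.

NOT IN PRINT; OUR BOOKKEEPING (unit `b2b-balaban-gan24-p2`, gen 33 = prover-b2b-balaban-gan24-p2-g33-0, road-P2 chair of row G-an2-4; CRUX TEAM (2), 2026-08-21; the owner's gen-6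
`mkroot.py` METHOD: the base proofs VERBATIM with `borderInc 3 Lc M κ u ↦ borderSum M (fun κ₀ z₀ => vhSAt (toSite r) 3 Lc rfl κ₀ z₀) κ u`, one extra binder `(hr : r ∈ box (3+1) Lc)`, MY `TaylorMassVHSymAt` letters
(`abs_borderSumV_le`, `borderSumV_ne_zero`, `borderSumV_inr_{left,right}_ne_zero_proj`) and `E3UnitSplitLevelsVSymAt.e3VHTop_unit_split_at` in place of VH1 ∕ the base template;
the base's root-free `sum_sum_le_card_mul` ∕ `prefactor_le`, VH1's `card_filter_coarse_l1_le`, L2's `card_filter_l1_le`, leaf-12's `TaylorVHSandwich.abs_twoChannel_le`, the leg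
packages `StencilSlotE3PhiLeg.phiLeg_three` ∕ `StencilSlotE3HLeg.legs_three` BY NAME; base modules untouched).  [folklore]; 0 `def`, 0 cited facts, 0 `def … : Prop`, 0 sorry;
NO new estimate of Bałaban's.  HONEST FRAMING (cell contract, verbatim): «discharging `BetaPertH` makes Bałaban's UV stability UNCONDITIONAL — a real constructive-QFT
result; it is NOT the continuum limit and NOT the Clay problem.»  HONEST DEPENDENCY (verbatim): «continuum YM on T⁴ ⇐ BetaPertH ∧ nine spine estimates (0/9 proved); BetaPertH
⇐ (D1) ∧ (D4) ∧ CAP+tail; G-an2-4 gates asym, D1 and NE2/3/4.»  Discharges NOTHING of (hS, hSall) ∕ hB by itself (an INPUT of the V half's (V-U)); NEVER «G-an2-4 closed»;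
NOT D1, NOT BetaPertH, NOT continuum, NOT Clay.
-/

noncomputable section

open Finset
open scoped BigOperators
open Literature.MathematicalPhysics.QuantumFieldTheory Literature.MathematicalPhysics.QuantumFieldTheory.Balaban1983to89
open Literature.MathematicalPhysics.QuantumFieldTheory.Balaban1983to89.Beta
open Literature.Probability.LatticeModels (Torus.proj)
open B12Sec2to5 (l1 l1_nonneg)
open ExpKernelCalculus (MKer Zl Zl_pos l1_sub_symm l1_sub_triangle)
open LatticeForm (quo)
open KernelSpecInstance (wH)
open KKTFluctuationKernel (GamΦ)
open OneStepResolventKernel (Fib LocStencil KInv)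
open AffineAveraging (box toSite)
open AveragingHessianKernels (ell)
open DecLiftAdjoint (borderSum)
open AveragingHessianKernelsRooted (vhSAt)
open Summit.QuantumFields.BalabanUV.Beta.GAN24.E3UnitSplit (e3OfS e3OfS_inl_inr e3OfS_inr)
open Summit.QuantumFields.BalabanUV.Beta.GAN24.E3UnitSplitLevelsVSymAt (e3VHTop_unit_split_at)
open Summit.QuantumFields.BalabanUV.Beta.GAN24.StencilSlotE3PhiLeg (phiLeg_three)
open Summit.QuantumFields.BalabanUV.Beta.GAN24.TaylorMassLam (card_filter_l1_le)
open Summit.QuantumFields.BalabanUV.Beta.GAN24.TaylorMassVH (card_filter_coarse_l1_le)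
open Summit.QuantumFields.BalabanUV.Beta.GAN24.TaylorMassVHSymAt (abs_borderSumV_le borderSumV_ne_zero borderSumV_inr_right_ne_zero_proj
  borderSumV_inr_left_ne_zero_proj)
open Summit.QuantumFields.BalabanUV.Beta.GAN24.TaylorVHSandwich (abs_twoChannel_le)
open Summit.QuantumFields.BalabanUV.Beta.GAN24.StencilSlotE3HLeg (legs_three)
open Summit.QuantumFields.BalabanUV.Beta.GAN24.S3ShapeVt (sum_sum_le_card_mul prefactor_le)

namespace Summit.QuantumFields.BalabanUV.Beta.GAN24.S3ShapeVtSymAt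

variable {d : ℕ}

/-! ## §1 Two-leg row masses of the border increment (generic `d`) -/

section RowMass

variable {Lc : ℕ} {r : Fin (d + 1) → ℕ} (M : ℕ) [NeZero M]

/-- **ROW MASS, block (inr μ, inl α)** [folklore]: for fixed background bond `(κ, u)`, summing the border increment's absolute entries over the
MULTIPLIER first leg `w ∈ S` and the FIELD second leg `y ∈ T` (ANY finite sets):
`≤ (2R_V+1)^{d+1} · (2R_V M+1)^{d+1} · (M·3ℓ²∕M^{d+1})`, `R_V = 2(d+1)(Lc+1) + 2d+3` (multiplier leg `M`-coarse within `R_V·M` of `u`, field leg within `R_V·M`). -/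
theorem rowMass_borderSumV_inr_inl (hL : 1 ≤ Lc) (hr : r ∈ box (d + 1) Lc) (κ : Fin (d + 1)) (u : Fin (d + 1) → ℤ) (μ α : Fin (d + 1))
    (S T : Finset (Fin (d + 1) → ℤ)) :
    ∑ w ∈ S, ∑ y ∈ T, |borderSum M (fun κ₀ z₀ => vhSAt (toSite r) d Lc rfl κ₀ z₀) κ u w y (Sum.inr μ) (Sum.inl α)| ≤
      ((2 * (2 * (d + 1) * (Lc + 1) + (2 * d + 3)) + 1) ^ (d + 1) : ℕ) *
        ((2 * ((2 * (d + 1) * (Lc + 1) + (2 * d + 3)) * M) + 1) ^ (d + 1) : ℕ) *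
          ((M : ℝ) * (3 * (ell (d + 1) Lc : ℝ) ^ 2 / (M : ℝ) ^ (d + 1))) := by
  classical
  set RV : ℕ := 2 * (d + 1) * (Lc + 1) + (2 * d + 3) with hRV
  set S' := S.filter fun w => Torus.proj M w = 0 ∧ l1 (w - u) ≤ ((RV * M : ℕ) : ℝ) with hS'
  set T' := T.filter fun y => l1 (y - u) ≤ ((RV * M : ℕ) : ℝ) with hT'
  have h := sum_sum_le_card_mul (S := S) (T := T) (S' := S') (T' := T') (Finset.filter_subset _ _) (Finset.filter_subset _ _)
    (F := fun w y => borderSum M (fun κ₀ z₀ => vhSAt (toSite r) d Lc rfl κ₀ z₀) κ u w y (Sum.inr μ) (Sum.inl α))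
    (fun w y => abs_borderSumV_le M hL hr κ u w y _ _)
    (fun w hw hw' y => by
      by_contra hne
      apply hw'
      rw [hS', Finset.mem_filter]
      exact ⟨hw, borderSumV_inr_left_ne_zero_proj M (toSite r) hne, (borderSumV_ne_zero M hL hr hne).1⟩)
    (fun y hy hy' w => by
      by_contra hne
      apply hy'
      rw [hT', Finset.mem_filter]
      exact ⟨hy, (borderSumV_ne_zero M hL hr hne).2⟩)
  refine h.trans ?_
  have hc1 : (S'.card : ℝ) ≤ ((2 * RV + 1) ^ (d + 1) : ℕ) := by exact_mod_cast card_filter_coarse_l1_le M S u RV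
  have hc2 : (T'.card : ℝ) ≤ ((2 * (RV * M) + 1) ^ (d + 1) : ℕ) := by exact_mod_cast card_filter_l1_le T u (RV * M)
  have hB : (0 : ℝ) ≤ (M : ℝ) * (3 * (ell (d + 1) Lc : ℝ) ^ 2 / (M : ℝ) ^ (d + 1)) := by positivity
  gcongr

/-- **ROW MASS, block (inl α, inr μ)** [folklore] (the mirror block: FIELD first leg, MULTIPLIER second leg). -/
theorem rowMass_borderSumV_inl_inr (hL : 1 ≤ Lc) (hr : r ∈ box (d + 1) Lc) (κ : Fin (d + 1)) (u : Fin (d + 1) → ℤ) (α μ : Fin (d + 1))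
    (S T : Finset (Fin (d + 1) → ℤ)) :
    ∑ w ∈ S, ∑ y ∈ T, |borderSum M (fun κ₀ z₀ => vhSAt (toSite r) d Lc rfl κ₀ z₀) κ u w y (Sum.inl α) (Sum.inr μ)| ≤
      ((2 * (2 * (d + 1) * (Lc + 1) + (2 * d + 3)) + 1) ^ (d + 1) : ℕ) *
        ((2 * ((2 * (d + 1) * (Lc + 1) + (2 * d + 3)) * M) + 1) ^ (d + 1) : ℕ) *
          ((M : ℝ) * (3 * (ell (d + 1) Lc : ℝ) ^ 2 / (M : ℝ) ^ (d + 1))) := by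
  classical
  set RV : ℕ := 2 * (d + 1) * (Lc + 1) + (2 * d + 3) with hRV
  set S' := S.filter fun w => l1 (w - u) ≤ ((RV * M : ℕ) : ℝ) with hS'
  set T' := T.filter fun y => Torus.proj M y = 0 ∧ l1 (y - u) ≤ ((RV * M : ℕ) : ℝ) with hT'
  have h := sum_sum_le_card_mul (S := S) (T := T) (S' := S') (T' := T') (Finset.filter_subset _ _) (Finset.filter_subset _ _)
    (F := fun w y => borderSum M (fun κ₀ z₀ => vhSAt (toSite r) d Lc rfl κ₀ z₀) κ u w y (Sum.inl α) (Sum.inr μ))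
    (fun w y => abs_borderSumV_le M hL hr κ u w y _ _)
    (fun w hw hw' y => by
      by_contra hne
      apply hw'
      rw [hS', Finset.mem_filter]
      exact ⟨hw, (borderSumV_ne_zero M hL hr hne).1⟩)
    (fun y hy hy' w => by
      by_contra hne
      apply hy'
      rw [hT', Finset.mem_filter]
      exact ⟨hy, borderSumV_inr_right_ne_zero_proj M (toSite r) hne, (borderSumV_ne_zero M hL hr hne).2⟩)
  refine h.trans ?_
  have hc1 : (S'.card : ℝ) ≤ ((2 * (RV * M) + 1) ^ (d + 1) : ℕ) := by exact_mod_cast card_filter_l1_le S u (RV * M)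
  have hc2 : (T'.card : ℝ) ≤ ((2 * RV + 1) ^ (d + 1) : ℕ) := by exact_mod_cast card_filter_coarse_l1_le M T u RV
  have hB : (0 : ℝ) ≤ (M : ℝ) * (3 * (ell (d + 1) Lc : ℝ) ^ 2 / (M : ℝ) ^ (d + 1)) := by positivity
  calc (S'.card : ℝ) * (T'.card : ℝ) * ((M : ℝ) * (3 * (ell (d + 1) Lc : ℝ) ^ 2 / (M : ℝ) ^ (d + 1)))
      ≤ ((2 * (RV * M) + 1) ^ (d + 1) : ℕ) * ((2 * RV + 1) ^ (d + 1) : ℕ) * ((M : ℝ) * (3 * (ell (d + 1) Lc : ℝ) ^ 2 / (M : ℝ) ^ (d + 1))) := by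
        gcongr
    _ = _ := by ring

end RowMass

/-! ## §2 Row S3-Vt at `d = 3` -/

/-- **ROW S3-Vt FROM THE TWO SANDWICH LEGS** (`d = 3`; `Lc ≥ 1`): the hypotheses are LITERALLY the two clauses of the owner's
`StencilSlotE3HLeg.legs_three` (`H̃` to the source block, all members; `G̃` from the read-out block); the K-slot `mm` leg is
`StencilSlotE3PhiLeg.phiLeg_three` (TREE, unconditional at `d = 3`); the table facts are leaf-11's VH1.  Conclusion = the hypothesis `hVt` of
`StencilSlotE3OfPieces.e3Shape_of_pieces` (statement copied from staged 2cc3c5eb8d83de1a), `d = 3`, with `(CtV, δ)` displayed below. [folklore] -/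
theorem shapeVt_of_legs_at {Lc : ℕ} [NeZero Lc] (hLc : 1 ≤ Lc) (cVH : ℝ) {CH κH : ℝ} (hκH : 0 < κH) (hCH : 0 ≤ CH)
    (hH : ∀ (j : ℕ) (k l : Fin (3 + 1)) (u u' : Fin (3 + 1) → ℤ),
      |((Lc : ℝ) ^ (j + 1)) ^ (3 + 2) * wH (N := Lc ^ (j + 1)) k l (u - (((Lc ^ (j + 1) : ℕ) : ℤ)) • u')| ≤
        CH * Real.exp (-κH * l1 (quo (Lc ^ (j + 1)) u - u')))
    (hG : ∀ (j : ℕ) (α l : Fin (3 + 1)) (x' w : Fin (3 + 1) → ℤ),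
      |((Lc : ℝ) ^ (j + 1)) ^ (3 + 2) * GamΦ (N := Lc ^ (j + 1)) α x' l w| ≤
        CH * Real.exp (-κH * l1 (x' - quo (Lc ^ (j + 1)) w))) :
    ∃ CtV δ : ℝ, 0 < δ ∧ ∀ (r : Fin (3 + 1) → ℕ), r ∈ box (3 + 1) Lc → ∀ n : ℕ, LocStencil (fun κ' u' x' z' a b => ((Lc : ℝ) ^ (n + 1 + 1)) ^ (2 * (3 + 1)) *
      e3OfS (Lc ^ (n + 1 + 1)) (fun κ u => (cVH * ((Lc : ℝ) ^ (n + 1)) ^ (3 + 2)) • borderSum (Lc ^ (n + 1)) (fun κ₀ z₀ => vhSAt (toSite r) 3 Lc rfl κ₀ z₀) κ u)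
        κ' u' x' z' a b) CtV δ := by
  classical
  obtain ⟨CΦ, δΦ, hδΦ, hCΦ, hΦx, hΦz⟩ := phiLeg_three (Lc := Lc)
  -- common rate and leg constant
  set κ : ℝ := min κH δΦ with hκdef
  have hκ : 0 < κ := lt_min hκH hδΦ
  have hκH' : κ ≤ κH := min_le_left _ _
  have hκΦ' : κ ≤ δΦ := min_le_right _ _
  set A : ℝ := max CH CΦ with hAdef
  have hA : 0 ≤ A := hCH.trans (le_max_left _ _)
  have hCHA : CH ≤ A := le_max_left _ _
  have hCΦA : CΦ ≤ A := le_max_right _ _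
  -- the row's geometry
  set RV : ℕ := 2 * (3 + 1) * (Lc + 1) + (2 * 3 + 3) with hRV
  set q : ℝ := 3 * (ell (3 + 1) Lc : ℝ) ^ 2 with hq
  have hq0 : 0 ≤ q := by positivity
  have hLcR : (1 : ℝ) ≤ Lc := by exact_mod_cast hLc
  have hLc0 : (0 : ℝ) < Lc := by positivity
  -- the displayed constant
  set K : ℝ := 2 * ((Fintype.card (Fin (3 + 1)) : ℝ) ^ 3 * A ^ 3 * Real.exp (κ * (4 * ((3 + 1 : ℕ) : ℝ) * RV + 2 * ((3 + 1 : ℕ) : ℝ)))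
    * Zl (3 + 1) (κ / 2)) with hK
  have hK0 : 0 ≤ K := by rw [hK]; have := (Zl_pos (D := 3 + 1) (half_pos hκ)).le; positivity
  refine ⟨|cVH| / (Lc : ℝ) ^ (3 + 1) * K * ((2 * (RV : ℝ) + 1) ^ 8 * q / (Lc : ℝ) ^ 2), κ / 2, half_pos hκ, fun r hr n => ?_⟩
  -- weakening of an exponential rate (`l1 ≥ 0`)
  have wk : ∀ {C C' ρ : ℝ} (v : Fin (3 + 1) → ℤ), 0 ≤ C → C ≤ C' → κ ≤ ρ →
      C * Real.exp (-ρ * l1 v) ≤ C' * Real.exp (-κ * l1 v) := by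
    intro C C' ρ v hC hCC' hρ
    refine mul_le_mul hCC' (Real.exp_le_exp.mpr ?_) (Real.exp_pos _).le (hC.trans hCC')
    have := l1_nonneg v
    nlinarith
  intro κ' u' x' z' a b
  dsimp only
  -- member `p = n+2`, level `M = Lc^{n+1}`
  set p : ℕ := n + 1 + 1 with hp
  have hNcast : (((Lc ^ p : ℕ) : ℝ)) = (Lc : ℝ) ^ p := by push_cast; rfl
  have hMcast : (((Lc ^ (n + 1) : ℕ) : ℝ)) = (Lc : ℝ) ^ (n + 1) := by push_cast; rfl
  have hm1 : (1 : ℝ) ≤ (Lc : ℝ) ^ (n + 1) := one_le_pow₀ hLcR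
  have hE0 : 0 ≤ |cVH| / (Lc : ℝ) ^ (3 + 1) * K * ((2 * (RV : ℝ) + 1) ^ 8 * q / (Lc : ℝ) ^ 2) *
      Real.exp (-(κ / 2) * (l1 (x' - u') + l1 (z' - u'))) := by positivity
  rcases a with α | μ
  swap
  · -- multiplier first leg: the `mm`-read vanishes
    simp only [e3OfS_inr, mul_zero, abs_zero]
    exact hE0
  rcases b with β | ν
  swap
  · simp only [e3OfS_inl_inr, mul_zero, abs_zero]
    exact hE0
  -- the (field, field) entry: unit split, then the two-channel sandwich
  rw [e3VHTop_unit_split_at (Lc := Lc) (d := 3) (toSite r) cVH (n + 1) p (by rw [hp]) κ' u' x' z' α β]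
  -- the sandwich bound
  have hS : ∀ (k : Fin (3 + 1)) (u w y : Fin (3 + 1) → ℤ) (a b : Fib 3), borderSum (Lc ^ (n + 1)) (fun κ₀ z₀ => vhSAt (toSite r) 3 Lc rfl κ₀ z₀) k u w y a b ≠ 0 →
      l1 (w - u) ≤ ((RV * Lc ^ (n + 1) : ℕ) : ℕ) ∧ l1 (y - u) ≤ ((RV * Lc ^ (n + 1) : ℕ) : ℕ) := fun k u w y a b h =>
    borderSumV_ne_zero (Lc ^ (n + 1)) hLc hr h
  have hb := abs_twoChannel_le (D := 3 + 1) (N := Lc ^ p) (ι := Fin (3 + 1))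
    (fun w l => ((Lc : ℝ) ^ p) ^ (2 * (3 + 1)) * KInv (N := Lc ^ p) (d := 3) (((Lc ^ p : ℕ) : ℤ) • x') w (Sum.inr α) (Sum.inr l))
    (fun w l => ((Lc : ℝ) ^ p) ^ (3 + 2) * GamΦ (N := Lc ^ p) α x' l w)
    (fun k u => ((Lc : ℝ) ^ p) ^ (3 + 2) * wH (N := Lc ^ p) k κ' (u - ((Lc ^ p : ℕ) : ℤ) • u'))
    (fun y l' => ((Lc : ℝ) ^ p) ^ (3 + 2) * wH (N := Lc ^ p) l' β (y - ((Lc ^ p : ℕ) : ℤ) • z'))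
    (fun y l' => ((Lc : ℝ) ^ p) ^ (2 * (3 + 1)) * KInv (N := Lc ^ p) (d := 3) y (((Lc ^ p : ℕ) : ℤ) • z') (Sum.inr l') (Sum.inr β))
    (fun k u w y l l' => borderSum (Lc ^ (n + 1)) (fun κ₀ z₀ => vhSAt (toSite r) 3 Lc rfl κ₀ z₀) k u w y (Sum.inr l) (Sum.inl l'))
    (fun k u w y l l' => borderSum (Lc ^ (n + 1)) (fun κ₀ z₀ => vhSAt (toSite r) 3 Lc rfl κ₀ z₀) k u w y (Sum.inl l) (Sum.inr l'))
    (x' := x') (u' := u') (z' := z') (A := A) (κ := κ)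
    (mP := ((2 * RV + 1) ^ (3 + 1) : ℕ) * ((2 * (RV * Lc ^ (n + 1)) + 1) ^ (3 + 1) : ℕ) *
      ((((Lc ^ (n + 1) : ℕ) : ℝ)) * (q / (((Lc ^ (n + 1) : ℕ) : ℝ)) ^ (3 + 1))))
    (R := RV * Lc ^ (n + 1)) hκ hA (by positivity)
    (fun w l => (hΦx (n + 1) x' w α l).trans (wk _ hCΦ hCΦA hκΦ'))
    (fun w l => (hG (n + 1) α l x' w).trans (by rw [l1_sub_symm]; exact wk _ hCH hCHA hκH'))
    (fun k u => (hH (n + 1) k κ' u u').trans (wk _ hCH hCHA hκH'))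
    (fun y l' => (hH (n + 1) l' β y z').trans (wk _ hCH hCHA hκH'))
    (fun y l' => (hΦz (n + 1) y z' l' β).trans (wk _ hCΦ hCΦA hκΦ'))
    (fun k u w y l l' h => hS k u w y _ _ h) (fun k u w y l l' h => hS k u w y _ _ h)
    (fun k u l l' S T => by simpa only [hq, mul_div_assoc] using rowMass_borderSumV_inr_inl (Lc ^ (n + 1)) hLc hr k u l l' S T)
    (fun k u l l' S T => by simpa only [hq, mul_div_assoc] using rowMass_borderSumV_inl_inr (Lc ^ (n + 1)) hLc hr k u l l' S T)
  -- match the bracket: the sandwich lemma reads the block average as `(((Lc^p : ℕ) : ℝ)^(3+1))⁻¹`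
  rw [hNcast] at hb
  -- absolute value of the prefactor
  rw [abs_mul, abs_mul, abs_mul, abs_neg, abs_div, abs_of_pos (pow_pos hLc0 _),
    abs_of_pos (zpow_pos (pow_pos hLc0 _) _), abs_of_pos (pow_pos hLc0 _)]
  refine (mul_le_mul_of_nonneg_left hb (by positivity)).trans ?_
  -- the arithmetic of the displayed constant
  have hgeo : ((Lc : ℝ) ^ p) ^ (-(2 : ℤ)) * (Lc : ℝ) ^ (n + 1) *
      (((2 * RV + 1) ^ (3 + 1) : ℕ) * ((2 * (RV * Lc ^ (n + 1)) + 1) ^ (3 + 1) : ℕ) *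
        ((((Lc ^ (n + 1) : ℕ) : ℝ)) * (q / (((Lc ^ (n + 1) : ℕ) : ℝ)) ^ (3 + 1))))
      ≤ (2 * (RV : ℝ) + 1) ^ 8 * q / (Lc : ℝ) ^ 2 := by
    have e1 : ((Lc : ℝ) ^ p) = (Lc : ℝ) ^ (n + 1) * Lc := by rw [hp, pow_succ]
    rw [e1, hMcast]
    push_cast
    have := prefactor_le (m := (Lc : ℝ) ^ (n + 1)) (L := (Lc : ℝ)) (r := (RV : ℝ)) (q := q) hm1 hLc0 (by positivity) hq0
    convert this using 2
    ring
  have hexp : Real.exp (κ * (4 * ((3 + 1 : ℕ) : ℝ) * ((RV * Lc ^ (n + 1) : ℕ) : ℝ) / ((Lc : ℝ) ^ p) + 2 * ((3 + 1 : ℕ) : ℝ)))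
      ≤ Real.exp (κ * (4 * ((3 + 1 : ℕ) : ℝ) * RV + 2 * ((3 + 1 : ℕ) : ℝ))) := by
    refine Real.exp_le_exp.mpr (mul_le_mul_of_nonneg_left ?_ hκ.le)
    have e1 : ((Lc : ℝ) ^ p) = (Lc : ℝ) ^ (n + 1) * Lc := by rw [hp, pow_succ]
    rw [e1]
    push_cast
    have h : (RV : ℝ) * (Lc : ℝ) ^ (n + 1) / ((Lc : ℝ) ^ (n + 1) * Lc) ≤ RV := by
      rw [div_le_iff₀ (by positivity)]
      have h0 : (0 : ℝ) ≤ (RV : ℝ) * (Lc : ℝ) ^ (n + 1) := by positivity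
      nlinarith [mul_le_mul_of_nonneg_left hLcR h0]
    have e2 : (4 : ℝ) * 4 * ((RV : ℝ) * (Lc : ℝ) ^ (n + 1)) / ((Lc : ℝ) ^ (n + 1) * Lc)
        = 4 * 4 * ((RV : ℝ) * (Lc : ℝ) ^ (n + 1) / ((Lc : ℝ) ^ (n + 1) * Lc)) := by ring
    rw [e2]
    linarith [mul_le_mul_of_nonneg_left h (by norm_num : (0 : ℝ) ≤ 4 * 4)]
  -- assemble
  set Ex : ℝ := Real.exp (-(κ / 2) * (l1 (x' - u') + l1 (z' - u'))) with hEx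
  have hEx0 : 0 ≤ Ex := (Real.exp_pos _).le
  set Z : ℝ := Zl (3 + 1) (κ / 2) with hZ
  have hZ0 : 0 ≤ Z := (Zl_pos (D := 3 + 1) (half_pos hκ)).le
  set c4 : ℝ := ((Fintype.card (Fin (3 + 1))) : ℝ) with hc4
  set mP : ℝ := ((2 * RV + 1) ^ (3 + 1) : ℕ) * ((2 * (RV * Lc ^ (n + 1)) + 1) ^ (3 + 1) : ℕ) *
    ((((Lc ^ (n + 1) : ℕ) : ℝ)) * (q / (((Lc ^ (n + 1) : ℕ) : ℝ)) ^ (3 + 1))) with hmP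
  have hmP0 : 0 ≤ mP := by positivity
  calc |cVH| / (Lc : ℝ) ^ (3 + 1) * ((Lc : ℝ) ^ p) ^ (-(2 : ℤ)) * (Lc : ℝ) ^ (n + 1) *
        (2 * (c4 ^ 3 * A ^ 3 * Real.exp (κ * (4 * ((3 + 1 : ℕ) : ℝ) * ((RV * Lc ^ (n + 1) : ℕ) : ℝ) / ((Lc : ℝ) ^ p) + 2 * ((3 + 1 : ℕ) : ℝ)))
          * mP * Z * Ex))
      = |cVH| / (Lc : ℝ) ^ (3 + 1) * (2 * c4 ^ 3 * A ^ 3 *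
          Real.exp (κ * (4 * ((3 + 1 : ℕ) : ℝ) * ((RV * Lc ^ (n + 1) : ℕ) : ℝ) / ((Lc : ℝ) ^ p) + 2 * ((3 + 1 : ℕ) : ℝ))) * Z) *
          (((Lc : ℝ) ^ p) ^ (-(2 : ℤ)) * (Lc : ℝ) ^ (n + 1) * mP) * Ex := by ring
    _ ≤ |cVH| / (Lc : ℝ) ^ (3 + 1) * (2 * c4 ^ 3 * A ^ 3 * Real.exp (κ * (4 * ((3 + 1 : ℕ) : ℝ) * RV + 2 * ((3 + 1 : ℕ) : ℝ))) * Z) *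
          ((2 * (RV : ℝ) + 1) ^ 8 * q / (Lc : ℝ) ^ 2) * Ex := by
        have h2 : ((Lc : ℝ) ^ p) ^ (-(2 : ℤ)) * (Lc : ℝ) ^ (n + 1) * mP ≤ (2 * (RV : ℝ) + 1) ^ 8 * q / (Lc : ℝ) ^ 2 := by
          rw [hmP]; exact hgeo
        have h0 : 0 ≤ ((Lc : ℝ) ^ p) ^ (-(2 : ℤ)) * (Lc : ℝ) ^ (n + 1) * mP := by positivity
        gcongr
    _ = |cVH| / (Lc : ℝ) ^ (3 + 1) * K * ((2 * (RV : ℝ) + 1) ^ 8 * q / (Lc : ℝ) ^ 2) * Ex := by rw [hK]; ring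

/-- **ROW S3-Vt OF THE S3 SHAPE TABLE, UNCONDITIONALLY AT `d = 3`** (every `Lc ≥ 1`, every `cVH`): the hypothesis `hVt` of
`StencilSlotE3OfPieces.e3Shape_of_pieces` (statement copied from staged 2cc3c5eb8d83de1a; `= S3.ShapeVt 3 Lc cVH CtV δ`) holds for SOME `CtV` and
SOME `δ > 0` — the legs from `StencilSlotE3HLeg.legs_three` and `StencilSlotE3PhiLeg.phiLeg_three`, the table facts from VH1, the engine
`TaylorVHSandwich`.  One row of twelve; discharges NOTHING of «E3Shape» ∕ (hS, hSall) by itself; NOT BetaPertH, NOT continuum, NOT Clay. [folklore] -/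
theorem shapeVt_three_at {Lc : ℕ} [NeZero Lc] (hLc : 1 ≤ Lc) (cVH : ℝ) :
    ∃ CtV δ : ℝ, 0 < δ ∧ ∀ (r : Fin (3 + 1) → ℕ), r ∈ box (3 + 1) Lc → ∀ n : ℕ, LocStencil (fun κ' u' x' z' a b => ((Lc : ℝ) ^ (n + 1 + 1)) ^ (2 * (3 + 1)) *
      e3OfS (Lc ^ (n + 1 + 1)) (fun κ u => (cVH * ((Lc : ℝ) ^ (n + 1)) ^ (3 + 2)) • borderSum (Lc ^ (n + 1)) (fun κ₀ z₀ => vhSAt (toSite r) 3 Lc rfl κ₀ z₀) κ u)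
        κ' u' x' z' a b) CtV δ := by
  obtain ⟨C, κ, hκ, hC, hH, hG⟩ := legs_three (Lc := Lc)
  exact shapeVt_of_legs_at hLc cVH hκ hC hH hG

end Summit.QuantumFields.BalabanUV.Beta.GAN24.S3ShapeVtSymAt

end
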